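import Literature.NumberTheory.EllipticCurves.ShaPrimaryModDivisibleSquare
import Literature.NumberTheory.EllipticCurves.IwasawaLeadingTermProofs
import HarnessLib

/-!
# BirchSwinnertonDyer / ShadowIsolation — crux `PhantomShadow` (stmt-BirchSwinnertonDyer-15787),
# line `Sketch` (card `kato-repulsion-depth-certificate`), first lemma L1 `TwoIndependentShaOfExactOrder`

The line's typed first lemma (`Cruxes/PhantomShadow/KatoRepulsionSketch.lean`,
`KatoRepulsion.TwoIndependentShaOfExactOrder`, with `PnIndependent` inlined), PROVED: granting the
Cassels–Tate pairing (`WeierstrassCurve.exists_casselsTate_pairing`, the tree's named fact bsd.S18,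
taken as a hypothesis exactly as the Sketch types it), an element `σ ∈ Ш(E/ℚ)` of EXACT order `p ^ n`
(`n ≥ 1`) forces: either `Ш(E/ℚ)[p^∞]` has positive `ℤ_p`-corank, or `Ш(E/ℚ)` contains two
`p ^ n`-independent classes `σ₁, σ₂` (`σ₁` of exact order `p ^ n`, `p ^ n ∣` the order of `σ₂`, and
`a σ₁ + b σ₂ = 0 ⇒ p ^ n ∣ a, b`). This is the uniform "`s_n ≥ 2`" input of the card's Kato-repulsion
bookkeeping (an exact-order-`pⁿ` class in a FINITE `Ш[p^∞]` sits in a copy of `(ℤ/pⁿ)²`, Cassels–Tate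
`Ш ≅ T ⊕ T` in its cheapest form).

Proof. Let `B` be the pairing, `k + 1 = n`. Dichotomy on the character `B (p^k σ) - = p^k • B σ -`:
* if it vanishes identically, `p^k σ` lies in the kernel of `B`, i.e. is DIVISIBLE in `Ш`
  (kernel clause of the fact), is non-zero (`p^k < p^n = ord σ`) and `p`-power torsion; a divisible
  element of `Ш[p^∞]` is divisible inside `Ш[p^∞]` (`mem_divisibleElements_primaryComponent_of_mem`), and a
  finite group has no non-zero divisible element (`divisibleElements_eq_bot_of_finite`); but corank `0` means
  `Ш[p^∞]` finite (`finite_primaryComponent_sha_iff_shaCorank_eq_zero`, weak Mordell–Weil inside) — so the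
  corank is positive;
* otherwise some `τ` has `β := B σ τ ∈ ℚ/ℤ` with `p^k β ≠ 0 = p^(k+1) β`, so `β` has order `p^n`
  (`addOrderOf_eq_prime_pow`); pairing `a σ + b τ = 0` with `σ` (alternation kills `B σ σ`) gives `b β = 0`,
  pairing it with `τ` gives `a β = 0`, whence `p^n ∣ a, b`; and `(ord τ) β = B σ ((ord τ) τ) = 0` gives
  `p^n ∣ ord τ`.
The first half is pure algebra and is stated for any alternating bi-additive pairing
(`indep_of_apply_nsmul_ne_zero`); the assembled statement is registered on the crux item as stub
`stub_twoIndependentShaOfExactOrder` (line `Sketch`) and proved here under that name.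
-/

set_option linter.dupNamespace false

noncomputable section

namespace Summit.BirchSwinnertonDyer.BirchSwinnertonDyer.Theorems

open Literature.NumberTheory.EllipticCurves

/-- Pure algebra of an alternating bi-additive pairing `B : T × T → Q`: if `σ` has exact order
`p ^ (k+1)` and the character `B (p ^ k • σ) -` does not vanish at `τ`, then `(σ, τ)` is a
`p ^ (k+1)`-independent pair: `p ^ (k+1)` divides the order of `τ`, and `a • σ + b • τ = 0` forces
`p ^ (k+1) ∣ a` and `p ^ (k+1) ∣ b`. [folklore] -/
theorem indep_of_apply_nsmul_ne_zero {T : Type*} [AddCommGroup T] {Q : Type*} [AddCommGroup Q]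
    (B : T →+ T →+ Q) (halt : ∀ x, B x x = 0) {p : ℕ} [hp : Fact p.Prime] {k : ℕ} {σ τ : T}
    (hσ : addOrderOf σ = p ^ (k + 1)) (hτ : B (p ^ k • σ) τ ≠ 0) :
    p ^ (k + 1) ∣ addOrderOf τ ∧
      ∀ a b : ℤ, a • σ + b • τ = 0 →
        ((p ^ (k + 1) : ℕ) : ℤ) ∣ a ∧ ((p ^ (k + 1) : ℕ) : ℤ) ∣ b := by
  -- the value `β = B σ τ` has exact order `p ^ (k+1)`
  set β : Q := B σ τ with hβ
  have hβk : ¬ p ^ k • β = 0 := by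
    intro h0
    apply hτ
    rw [map_nsmul, AddMonoidHom.nsmul_apply, h0]
  have hβn : p ^ (k + 1) • β = 0 := by
    rw [hβ, ← AddMonoidHom.nsmul_apply, ← map_nsmul, ← hσ, addOrderOf_nsmul_eq_zero, map_zero,
      AddMonoidHom.zero_apply]
  have hord : addOrderOf β = p ^ (k + 1) := addOrderOf_eq_prime_pow hβk hβn
  refine ⟨?_, fun a b hab ↦ ⟨?_, ?_⟩⟩
  · -- `(ord τ) • β = B σ ((ord τ) • τ) = 0`
    rw [← hord]
    apply addOrderOf_dvd_of_nsmul_eq_zero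
    rw [hβ, ← map_nsmul, addOrderOf_nsmul_eq_zero, map_zero]
  · -- pair with `τ` on the right: `a • β + b • B τ τ = 0`
    have h := congrArg (fun x ↦ B x τ) hab
    simp only [map_add, map_zsmul, AddMonoidHom.add_apply, AddMonoidHom.zsmul_apply, halt τ,
      smul_zero, add_zero, map_zero, AddMonoidHom.zero_apply] at h
    have := addOrderOf_dvd_iff_zsmul_eq_zero.mpr h
    rwa [hord] at this
  · -- pair with `σ` on the left: `a • B σ σ + b • β = 0`
    have h := congrArg (fun x ↦ B σ x) hab
    simp only [map_add, map_zsmul, halt σ, smul_zero, zero_add, map_zero] at h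
    have := addOrderOf_dvd_iff_zsmul_eq_zero.mpr h
    rwa [hord] at this

/-- A non-zero element of `Ш(E/K)[p^∞]` which is divisible in `Ш(E/K)` forces positive
`ℤ_p`-corank of `Ш(E/K)[p^∞]`: it is divisible inside the `p`-primary component
(`mem_divisibleElements_primaryComponent_of_mem`), a finite group has no non-zero divisible element
(`divisibleElements_eq_bot_of_finite`), and corank `0` means `Ш[p^∞]` is finite
(`finite_primaryComponent_sha_iff_shaCorank_eq_zero`). [folklore] -/
theorem shaCorank_ne_zero_of_mem_divisibleElements {K : Type} [Field K] [NumberField K]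
    (W : WeierstrassCurve K) [W.IsElliptic] (p : ℕ) [hp : Fact p.Prime] {x : W.sha}
    (hx : x ∈ AddCommGroup.primaryComponent W.sha p)
    (hdx : x ∈ AddSubgroup.divisibleElements W.sha) (hx0 : x ≠ 0) : W.shaCorank p ≠ 0 := by
  intro h0
  haveI : Finite (AddCommGroup.primaryComponent W.sha p) :=
    (finite_primaryComponent_sha_iff_shaCorank_eq_zero W p).mpr h0
  have hmem := mem_divisibleElements_primaryComponent_of_mem p hx hdx
  rw [divisibleElements_eq_bot_of_finite, AddSubgroup.mem_bot] at hmem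
  exact hx0 (congrArg Subtype.val hmem)

/-- **L1 `TwoIndependentShaOfExactOrder` of line `Sketch` (card `kato-repulsion-depth-certificate`),
stated verbatim (with `PnIndependent` inlined) and proved.** Granting the Cassels–Tate pairing
(`WeierstrassCurve.exists_casselsTate_pairing`: alternating, kernel = divisible elements; Cassels 1962,
Milne *ADT* I.6.13), an element of EXACT order `p ^ n`, `n ≥ 1`, in `Ш(E/ℚ)` forces either positive
`ℤ_p`-corank of `Ш(E/ℚ)[p^∞]` or two `p ^ n`-independent classes `σ₁, σ₂ ∈ Ш(E/ℚ)`. [folklore] -/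
theorem stub_twoIndependentShaOfExactOrder : ∀ (W : WeierstrassCurve ℚ) [W.IsElliptic] (p : ℕ) [Fact p.Prime] (n : ℕ), 1 ≤ n → WeierstrassCurve.exists_casselsTate_pairing (K := ℚ) → (∃ σ : W.sha, addOrderOf σ = p ^ n) → W.shaCorank p ≠ 0 ∨ ∃ σ₁ σ₂ : W.sha, addOrderOf σ₁ = p ^ n ∧ p ^ n ∣ addOrderOf σ₂ ∧ ∀ a b : ℤ, a • σ₁ + b • σ₂ = 0 → ((p ^ n : ℕ) : ℤ) ∣ a ∧ ((p ^ n : ℕ) : ℤ) ∣ b := by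
  intro W _ p hp n hn hCT hσ
  obtain ⟨σ, hσ⟩ := hσ
  obtain ⟨B, halt, hker⟩ := hCT W
  obtain ⟨k, rfl⟩ : ∃ k, n = k + 1 := ⟨n - 1, by omega⟩
  by_cases hvan : ∀ y, B (p ^ k • σ) y = 0
  · -- `p ^ k • σ` is a non-zero divisible element of `Ш[p^∞]`
    left
    refine shaCorank_ne_zero_of_mem_divisibleElements W p (x := p ^ k • σ) ?_ ((hker _).mp hvan) ?_
    · rw [AddCommGroup.mem_primaryComponent]
      exact ⟨1, by rw [pow_one, smul_smul, ← pow_succ', ← hσ, addOrderOf_nsmul_eq_zero]⟩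
    · have hlt : p ^ k < addOrderOf σ := by
        rw [hσ]
        exact Nat.pow_lt_pow_right hp.out.one_lt (lt_add_one k)
      exact nsmul_ne_zero_of_lt_addOrderOf (pow_ne_zero k hp.out.ne_zero) hlt
  · right
    push Not at hvan
    obtain ⟨τ, hτ⟩ := hvan
    exact ⟨σ, τ, hσ, indep_of_apply_nsmul_ne_zero B halt hσ hτ⟩

end Summit.BirchSwinnertonDyer.BirchSwinnertonDyer.Theorems

end
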